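import Literature.Probability.LatticeModels.ReflectionInvarianceStep
import HarnessLib

/-!
# No infinite butterflies ⇒ periodicity under `2ℤ^d` (Georgii–Higuchi 2000, Lemma 3.1, Step 1, end)

Topic `Probability/LatticeModels`; theorems only. Georgii–Higuchi, J. Math. Phys. 41 (2000), proof of
Lemma 3.1, Step 1 (p. 7): "First we observe that `μ` is `R∘T`-invariant for all reflections
`R = R_{k,hor}` or `R_{k,vert}`, and in particular is periodic under translations. … Since both
`ϑ²_hor` and `ϑ²_vert` are compositions of two reflections, the invariance under the translation
group `(ϑ_x)_{x∈2ℤ²}` follows."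

`ReflectionInvarianceStep.lean` proved the `R∘T`-invariance for the reflection in a coordinate
hyperplane through the origin. Here we

* transport tail triviality and the half-space percolation events `E^s_P` along lattice
  automorphisms (`IsTailTrivial.map_configRelabel`, `configRelabel_mem_existsInfClusterIn_iff`);
* deduce the `R_k∘T`-invariance for the reflection `R_k` in the translated hyperplane `{x_i = k}`
  from the absence of infinite `∓`butterflies across it, by conjugating with the translation by
  `k e_i` (`map_conjFlipReflect_eq_of_no_butterfly`);
* compose the flip-reflections about `{x_i = 0}` and `{x_i = 1}` into the translation by `2e_i`
  (`conjFlipReflect_one_comp_zero`), and close under the group law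
  (`map_configRelabel_shift_two_smul_eq_of_generators`):

**`map_configRelabel_two_smul_eq_of_no_butterflies`** — a tail-trivial `μ ∈ 𝒢(β, 0)` on `ℤ^d`
with no infinite butterflies of either sign across the hyperplanes `{x_i = 0}` and `{x_i = 1}`
(all `i`) is invariant under the translations of `2ℤ^d`.

## References

* H.-O. Georgii, Y. Higuchi, J. Math. Phys. 41 (2000) 1153–1169, Lemma 3.1, Step 1 of the proof,
  p. 7 [GeorgiiHiguchi2000].
-/

noncomputable section

open MeasureTheory Filter Topology Finset
open Literature.Probability.Percolation (siteCluster siteCluster_relabel zdShiftIso)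

namespace Literature.Probability.LatticeModels

/-! ### Transport along automorphisms -/

section Transport

variable {V : Type*} {G : SimpleGraph V}

/-- `S^s(ω ∘ φ⁻¹) = φ(S^s(ω))`. [cite: GeorgiiHiguchi2000, §2 p. 3] -/
theorem spinSites_configRelabel (φ : V ≃ V) (s : ℤˣ) (ω : SpinConfig V) :
    spinSites s (configRelabel φ ω) = φ '' spinSites s ω := by
  ext x
  simp only [mem_spinSites, configRelabel_apply, Set.mem_image]
  constructor
  · intro h; exact ⟨φ.symm x, h, φ.apply_symm_apply x⟩
  · rintro ⟨y, hy, rfl⟩; rwa [Equiv.symm_apply_apply]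

/-- The relabelling `ω ↦ ω ∘ φ⁻¹` is measurable from the spins in `φ⁻¹(Δ)` to the spins in `Δ`. [folklore] -/
theorem measurable_configRelabel_cylinderEvents (φ : V ≃ V) (Δ : Set V) :
    @Measurable (SpinConfig V) (SpinConfig V) (cylinderEvents (X := fun _ : V => ℤˣ) (φ.symm '' Δ))
      (cylinderEvents (X := fun _ : V => ℤˣ) Δ) (configRelabel φ) := by
  refine @measurable_cylinderEvents_iff _ _ _
    (cylinderEvents (X := fun _ : V => ℤˣ) (φ.symm '' Δ)) _ _ _ |>.2 ?_
  intro x hx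
  have : (fun ω : SpinConfig V => configRelabel φ ω x) = fun ω => ω (φ.symm x) := by
    funext ω; rfl
  rw [this]
  exact measurable_cylinderEvent_apply (X := fun _ : V => ℤˣ) (Set.mem_image_of_mem _ hx)

/-- **Tail triviality is preserved by relabelling along a bijection of the sites.** [cite: GeorgiiHiguchi2000, §2 p. 3] -/
theorem IsTailTrivial.map_configRelabel {μ : Measure (SpinConfig V)} (hμ : IsTailTrivial μ)
    (φ : V ≃ V) : IsTailTrivial (μ.map (configRelabel φ)) := by
  classical
  intro B hB
  have hBφ : MeasurableSet[tailEvents V ℤˣ] ((configRelabel φ) ⁻¹' B) := by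
    rw [measurableSet_tailEvents_iff] at hB ⊢
    intro Λ
    have h1 := measurable_configRelabel_cylinderEvents φ ((↑(Λ.image φ) : Set V)ᶜ) (hB (Λ.image φ))
    refine cylinderEvents_mono ?_ _ h1
    rintro _ ⟨x, hx, rfl⟩ hxΛ
    refine hx ?_
    rw [Finset.coe_image]
    exact ⟨φ.symm x, hxΛ, φ.apply_symm_apply x⟩
  rw [Measure.map_apply (configRelabel φ).measurable (MeasurableSet.of_tailEvents hB)]
  exact hμ _ hBφ

/-- **Transport of `E^s_P`**: `ω ∘ φ⁻¹ ∈ E^s_P ↔ ω ∈ E^s_{φ⁻¹(P)}` for a graph automorphism `φ`. [cite: GeorgiiHiguchi2000, §3 p. 6] -/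
theorem configRelabel_mem_existsInfClusterIn_iff (φ : G ≃g G) {s : ℤˣ} {P : Set V}
    {ω : SpinConfig V} :
    configRelabel φ.toEquiv ω ∈ existsInfClusterIn G s P ↔ ω ∈ existsInfClusterIn G s (φ ⁻¹' P) := by
  simp only [mem_existsInfClusterIn_iff, spinSites_configRelabel]
  have himg : φ.toEquiv '' spinSites s ω ∩ P = φ.toEquiv '' (spinSites s ω ∩ φ ⁻¹' P) := by
    change _ = ⇑φ.toEquiv '' (spinSites s ω ∩ ⇑φ.toEquiv ⁻¹' P)
    rw [Set.image_inter_preimage]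
  rw [himg]
  have key : ∀ y, siteCluster G (φ.toEquiv '' (spinSites s ω ∩ φ ⁻¹' P)) (φ y) =
      φ '' siteCluster G (spinSites s ω ∩ φ ⁻¹' P) y := fun y => by
    have h := siteCluster_relabel φ (spinSites s ω ∩ φ ⁻¹' P) y
    rwa [Literature.Probability.Percolation.SiteConfig.relabel_apply] at h
  constructor
  · rintro ⟨x, hx⟩
    refine ⟨φ.symm x, ?_⟩
    have hk := key (φ.symm x)
    rw [RelIso.apply_symm_apply] at hk
    rw [hk] at hx
    exact Set.Infinite.of_image _ hx
  · rintro ⟨y, hy⟩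
    refine ⟨φ y, ?_⟩
    rw [key]
    exact hy.image φ.injective.injOn

end Transport

/-! ### Translations of `ℤ^d` acting on spin configurations -/

section Shifts

variable {d : ℕ}

/-- `(T_v ω)(x) = ω(x - v)` for the translation `T_v = configRelabel (Site.shift v)`. [folklore] -/
theorem configRelabel_shift_apply (v : Site d) (ω : SpinConfig (Site d)) (x : Site d) :
    configRelabel (Site.shift v) ω x = ω (x - v) := by
  rw [configRelabel_apply, Site.shift_symm_apply]

/-- `T_{u+w} = T_u ∘ T_w`. [folklore] -/
theorem configRelabel_shift_add (u w : Site d) :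
    (configRelabel (Site.shift (u + w)) : SpinConfig (Site d) → SpinConfig (Site d)) =
      configRelabel (Site.shift u) ∘ configRelabel (Site.shift w) := by
  funext ω; funext x
  simp only [Function.comp_apply, configRelabel_shift_apply]
  congr 1; abel

/-- `T_0 = id`. [folklore] -/
theorem configRelabel_shift_zero :
    (configRelabel (Site.shift (0 : Site d)) : SpinConfig (Site d) → SpinConfig (Site d)) = id := by
  funext ω; funext x
  rw [configRelabel_shift_apply, sub_zero]; rfl

/-- The invariance vectors of a measure form a subgroup: invariance under the shifts by `2e_i` for
all `i` gives invariance under all of `2ℤ^d`. [cite: GeorgiiHiguchi2000, Lemma 3.1 (proof, Step 1, p. 7)] -/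
theorem map_configRelabel_shift_two_smul_eq_of_generators {μ : Measure (SpinConfig (Site d))}
    (hgen : ∀ i : Fin d, μ.map (configRelabel (Site.shift ((2 : ℤ) • (Pi.single i 1 : Site d)))) = μ) :
    ∀ v : Site d, μ.map (configRelabel (Site.shift ((2 : ℤ) • v))) = μ := by
  have hmeas : ∀ u : Site d, Measurable (configRelabel (Site.shift u)) := fun u =>
    (configRelabel (Site.shift u)).measurable
  -- the set of invariance vectors is a subgroup
  let S : AddSubgroup (Site d) :=
    { carrier := {u | μ.map (configRelabel (Site.shift u)) = μ}
      add_mem' := fun {a b} ha hb => by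
        simp only [Set.mem_setOf_eq] at ha hb ⊢
        rw [configRelabel_shift_add, ← Measure.map_map (hmeas a) (hmeas b), hb, ha]
      zero_mem' := by
        simp only [Set.mem_setOf_eq]
        rw [configRelabel_shift_zero, Measure.map_id]
      neg_mem' := fun {a} ha => by
        simp only [Set.mem_setOf_eq] at ha ⊢
        conv_lhs => rw [← ha]
        rw [Measure.map_map (hmeas (-a)) (hmeas a), ← configRelabel_shift_add, neg_add_cancel,
          configRelabel_shift_zero, Measure.map_id] }
  intro v
  have hv : (2 : ℤ) • v = ∑ i, v i • ((2 : ℤ) • (Pi.single i 1 : Site d)) := by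
    conv_lhs => rw [← Finset.univ_sum_single v]
    rw [Finset.smul_sum]
    refine Finset.sum_congr rfl fun i _ => ?_
    ext j
    simp only [Pi.smul_apply, Pi.single_apply, smul_eq_mul]
    split_ifs <;> ring
  rw [hv]
  exact S.sum_mem fun i _ => S.zsmul_mem (hgen i) (v i)

end Shifts

/-! ### Flip-reflections in translated hyperplanes -/

section Reflections

variable {d : ℕ} {β : ℝ}

/-- The inverse bijection of a coordinate reflection is itself. [folklore] -/
theorem reflectCoord_symm_apply (i : Fin d) (x : Site d) :
    (reflectCoord i).toEquiv.symm x = reflectCoord i x := by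
  rw [Equiv.symm_apply_eq]
  exact (reflectCoord_reflectCoord i x).symm

/-- The **flip-reflection about the hyperplane `{x_i = k}`**, `R_k∘T = T_{ke_i} ∘ (R_0∘T) ∘ T_{-ke_i}`,
evaluated: `(R_k∘T ω)(x) = -ω(R_0 x + 2k e_i)`. [cite: GeorgiiHiguchi2000, §2 p. 3] -/
theorem conjFlipReflect_apply (i : Fin d) (k : ℤ) (ω : SpinConfig (Site d)) (x : Site d) :
    (configRelabel (Site.shift (k • (Pi.single i 1 : Site d))) ∘ flipRelabel (reflectCoord i).toEquiv ∘
      configRelabel (Site.shift (-(k • (Pi.single i 1 : Site d))))) ω x =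
      -ω (reflectCoord i x + (2 * k) • (Pi.single i 1 : Site d)) := by
  simp only [Function.comp_apply, configRelabel_shift_apply, flipRelabel_apply,
    reflectCoord_symm_apply]
  congr 2
  funext j
  simp only [Pi.sub_apply, Pi.add_apply, Pi.neg_apply, Pi.smul_apply, Pi.single_apply,
    smul_eq_mul, reflectCoord_apply]
  split_ifs <;> ring

/-- **Two flip-reflections compose to a double shift**:
`(R_1∘T) ∘ (R_0∘T) = T_{2e_i}` (Georgii–Higuchi 2000, p. 7: "`ϑ²_hor` and `ϑ²_vert` are
compositions of two reflections"). [cite: GeorgiiHiguchi2000, Lemma 3.1 (proof, Step 1, p. 7)] -/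
theorem conjFlipReflect_one_comp_zero (i : Fin d) :
    (configRelabel (Site.shift ((1 : ℤ) • (Pi.single i 1 : Site d))) ∘
        flipRelabel (reflectCoord i).toEquiv ∘
        configRelabel (Site.shift (-((1 : ℤ) • (Pi.single i 1 : Site d))))) ∘
      (configRelabel (Site.shift ((0 : ℤ) • (Pi.single i 1 : Site d))) ∘
        flipRelabel (reflectCoord i).toEquiv ∘
        configRelabel (Site.shift (-((0 : ℤ) • (Pi.single i 1 : Site d))))) =
      (configRelabel (Site.shift ((2 : ℤ) • (Pi.single i 1 : Site d))) :
        SpinConfig (Site d) → SpinConfig (Site d)) := by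
  funext ω; funext x
  rw [Function.comp_apply, conjFlipReflect_apply, conjFlipReflect_apply, configRelabel_shift_apply,
    neg_neg]
  congr 1
  funext j
  simp only [Pi.sub_apply, Pi.add_apply, Pi.smul_apply, Pi.single_apply, smul_eq_mul,
    reflectCoord_apply]
  split_ifs <;> ring

/-- Translated half-spaces: `{x | x - k e_i ∈ π_up} = {x | k ≤ x_i}` … [folklore] -/
theorem preimage_zdShiftIso_upperHalfSpace (i : Fin d) (k : ℤ) :
    (zdShiftIso (-(k • (Pi.single i 1 : Site d)))) ⁻¹' upperHalfSpace i = {x : Site d | k ≤ x i} := by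
  ext x
  simp [upperHalfSpace]

/-- … and `{x | x - k e_i ∈ π_down} = {x | x_i ≤ k}`. [folklore] -/
theorem preimage_zdShiftIso_lowerHalfSpace (i : Fin d) (k : ℤ) :
    (zdShiftIso (-(k • (Pi.single i 1 : Site d)))) ⁻¹' lowerHalfSpace i = {x : Site d | x i ≤ k} := by
  ext x
  simp [lowerHalfSpace]

/-- **Step 1 for translated hyperplanes** (Georgii–Higuchi 2000, proof of Lemma 3.1, Step 1, p. 7,
"`μ` is `R∘T`-invariant for all reflections `R = R_{k,hor}` or `R_{k,vert}`"): for `β ≥ 0`, a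
tail-trivial `μ ∈ 𝒢(β, 0)` on `ℤ^d` with no infinite `-`butterfly and no infinite `+`butterfly
across the hyperplane `{x_i = k}` is invariant under the flip-reflection about it. Proof: apply
`map_flipRelabel_eq_of_no_butterfly` to the translate `μ ∘ T_{-ke_i}⁻¹`. [cite: GeorgiiHiguchi2000, Lemma 3.1 (proof, Step 1, p. 7)] -/
theorem map_conjFlipReflect_eq_of_no_butterfly (hβ : 0 ≤ β) {μ : Measure (SpinConfig (Site d))}
    (hμ : μ ∈ isingGibbsMeasures d β 0) (hμt : IsTailTrivial μ) (i : Fin d) (k : ℤ)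
    (hminus : μ (existsInfClusterIn (zdGraph d) (-1) {x : Site d | k ≤ x i} ∩
      existsInfClusterIn (zdGraph d) (-1) {x : Site d | x i ≤ k}) = 0)
    (hplus : μ (existsInfClusterIn (zdGraph d) 1 {x : Site d | k ≤ x i} ∩
      existsInfClusterIn (zdGraph d) 1 {x : Site d | x i ≤ k}) = 0) :
    μ.map (configRelabel (Site.shift (k • (Pi.single i 1 : Site d))) ∘
      flipRelabel (reflectCoord i).toEquiv ∘
      configRelabel (Site.shift (-(k • (Pi.single i 1 : Site d))))) = μ := by
  have hμG : IsGibbsMeasure (isingSpecification (zdGraph d) β 0) μ := hμ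
  haveI := hμG.isProbabilityMeasure
  set v : Site d := -(k • (Pi.single i 1 : Site d)) with hv
  set T : SpinConfig (Site d) → SpinConfig (Site d) := ⇑(configRelabel (Site.shift v)) with hT
  have hTm : Measurable T := (configRelabel (Site.shift v)).measurable
  have hTφ : T = configRelabel (zdShiftIso v).toEquiv := rfl
  -- the translated measure
  set μ' := μ.map T with hμ'
  have hμ'G : μ' ∈ isingGibbsMeasures d β 0 := by
    rw [hμ', hTφ]; exact IsGibbsMeasure.map_configRelabel _ (zdShiftIso v) hμG
  have hμ't : IsTailTrivial μ' := IsTailTrivial.map_configRelabel hμt _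
  -- its butterfly events are the translated ones
  have hmeasE : ∀ (s : ℤˣ) (P : Set (Site d)), MeasurableSet (existsInfClusterIn (zdGraph d) s P) :=
    fun s P => MeasurableSet.of_tailEvents (measurableSet_tailEvents_existsInfClusterIn s P)
  have hpre : ∀ s : ℤˣ, T ⁻¹' (existsInfClusterIn (zdGraph d) s (upperHalfSpace i) ∩
      existsInfClusterIn (zdGraph d) s (lowerHalfSpace i)) =
      existsInfClusterIn (zdGraph d) s {x : Site d | k ≤ x i} ∩
        existsInfClusterIn (zdGraph d) s {x : Site d | x i ≤ k} := fun s => by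
    ext ω
    simp only [Set.mem_preimage, Set.mem_inter_iff, hTφ, configRelabel_mem_existsInfClusterIn_iff,
      hv, preimage_zdShiftIso_upperHalfSpace, preimage_zdShiftIso_lowerHalfSpace]
  have hminus' : μ' (existsInfClusterIn (zdGraph d) (-1) (upperHalfSpace i) ∩
      existsInfClusterIn (zdGraph d) (-1) (lowerHalfSpace i)) = 0 := by
    rw [hμ', Measure.map_apply hTm ((hmeasE _ _).inter (hmeasE _ _)), hpre]; exact hminus
  have hplus' : μ' (existsInfClusterIn (zdGraph d) 1 (upperHalfSpace i) ∩
      existsInfClusterIn (zdGraph d) 1 (lowerHalfSpace i)) = 0 := by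
    rw [hμ', Measure.map_apply hTm ((hmeasE _ _).inter (hmeasE _ _)), hpre]; exact hplus
  -- Step 1 for `μ'`, translated back
  have hstep := map_flipRelabel_eq_of_no_butterfly hβ hμ'G hμ't i hminus' hplus'
  have hRm : Measurable (flipRelabel (reflectCoord i).toEquiv) := measurable_flipRelabel _
  have hTm' : Measurable (configRelabel (Site.shift (k • (Pi.single i 1 : Site d)))) :=
    (configRelabel _).measurable
  have hback : (configRelabel (Site.shift (k • (Pi.single i 1 : Site d))) :
      SpinConfig (Site d) → SpinConfig (Site d)) ∘ T = id := by
    rw [hT, ← configRelabel_shift_add, hv, add_neg_cancel, configRelabel_shift_zero]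
  calc μ.map (configRelabel (Site.shift (k • (Pi.single i 1 : Site d))) ∘
        flipRelabel (reflectCoord i).toEquiv ∘ T)
      = ((μ.map T).map (flipRelabel (reflectCoord i).toEquiv)).map
          (configRelabel (Site.shift (k • (Pi.single i 1 : Site d)))) := by
        rw [Measure.map_map hRm hTm, Measure.map_map hTm' (hRm.comp hTm)]
    _ = (μ.map T).map (configRelabel (Site.shift (k • (Pi.single i 1 : Site d)))) := by
        rw [← hμ', hstep]
    _ = μ := by rw [Measure.map_map hTm' hTm, hback, Measure.map_id]

/-- **No infinite butterflies ⇒ `2ℤ^d`-periodicity** (Georgii–Higuchi 2000, proof of Lemma 3.1,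
Step 1, p. 7: "in particular [μ] is periodic under translations … the invariance under the
translation group `(ϑ_x)_{x∈2ℤ²}` follows"): for `β ≥ 0`, a tail-trivial `μ ∈ 𝒢(β, 0)` on `ℤ^d`
without infinite `-`butterflies and without infinite `+`butterflies across the hyperplanes
`{x_i = 0}` and `{x_i = 1}`, for every `i`, satisfies `μ ∘ T_{2v}⁻¹ = μ` for all `v ∈ ℤ^d`. [cite: GeorgiiHiguchi2000, Lemma 3.1 (proof, Step 1, p. 7)] -/
theorem map_configRelabel_two_smul_eq_of_no_butterflies (hβ : 0 ≤ β)
    {μ : Measure (SpinConfig (Site d))} (hμ : μ ∈ isingGibbsMeasures d β 0) (hμt : IsTailTrivial μ)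
    (hno : ∀ (i : Fin d) (k : ℤ), (k = 0 ∨ k = 1) → ∀ s : ℤˣ,
      μ (existsInfClusterIn (zdGraph d) s {x : Site d | k ≤ x i} ∩
        existsInfClusterIn (zdGraph d) s {x : Site d | x i ≤ k}) = 0)
    (v : Site d) : μ.map (configRelabel (Site.shift ((2 : ℤ) • v))) = μ := by
  refine map_configRelabel_shift_two_smul_eq_of_generators (fun i => ?_) v
  have h0 := map_conjFlipReflect_eq_of_no_butterfly hβ hμ hμt i 0 (hno i 0 (Or.inl rfl) (-1))
    (hno i 0 (Or.inl rfl) 1)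
  have h1 := map_conjFlipReflect_eq_of_no_butterfly hβ hμ hμt i 1 (hno i 1 (Or.inr rfl) (-1))
    (hno i 1 (Or.inr rfl) 1)
  have hm : ∀ k : ℤ, Measurable (configRelabel (Site.shift (k • (Pi.single i 1 : Site d))) ∘
      flipRelabel (reflectCoord i).toEquiv ∘
      configRelabel (Site.shift (-(k • (Pi.single i 1 : Site d))))) := fun k =>
    (configRelabel _).measurable.comp ((measurable_flipRelabel _).comp (configRelabel _).measurable)
  rw [← conjFlipReflect_one_comp_zero i, ← Measure.map_map (hm 1) (hm 0)]
  simp only [one_smul, zero_smul, neg_zero] at h0 h1 ⊢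
  rw [h0, h1]

end Reflections

end Literature.Probability.LatticeModels
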